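import Mathlib
import HarnessLib
import Summits.Ventures.LatticeQCDFlow.Exactness.SU2FTHMCTranslationCovariance
import Summits.Ventures.LatticeQCDFlow.Exactness.SU2FTHMCGaugeInvariantObservables

/-!
# Translation-invariant observables have the same expectations along the `SU(2)` FT-HMC run from translated and from untranslated initial data

HONEST FRAMING: exact (Metropolis-corrected) sampling algorithms for lattice gauge theory;
figures of merit are autocorrelation/cost numbers at stated couplings and volumes; no
continuum-physics claim.

Venture `LatticeQCDFlow` (cell pub-lqcd), topic `Exactness`; FANOUT row 14 (`eng-flowhmc`).  NEW WORK of
the cell; nothing is cited as a fact; no number.  The translation twin of GEN-10's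
`SU2FTHMCGaugeInvariantObservables` (there: class-function observables under gauge transformations),
by its generic lemmas `integral_iterate_bind_map_eq_of_conjKernel_eq_self` /
`integral_nHit_eq_of_conjKernel_eq_self` and GEN-10's `su2_fthmc_conjKernel_translate`:

* **`su2_fthmc_integral_translationInvariant_eq`** — translation-equivariant member, translation-invariant
  measurable `J`, `S`, translation-covariant measurable force routine, any `c`, `n`: for every
  translation-invariant observable `O` (`O(V·a) = O(V)`; e.g. the Wilson action, volume-averaged
  plaquettes or loops, the topological-charge estimators the cell scores) the expectation after `t`
  steps from `(Θ_a)_* μ₀` equals the expectation after `t` steps from `μ₀`;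
* **`su2_fthmc_nHit_integral_translationInvariant_eq`** — the same from the configurations `V·a` and `V`
  through the `t`-step kernel.

NOT CLAIMED: which observables the engine measures; members / forces beyond the hypotheses (see
`SU2WilsonFlowLOTranslation`, `SU2ResidualMemberTranslation`, `SU2ExactForceTranslationCovariance`
for discharging them); any number.
-/

noncomputable section

namespace Summit.Ventures.LatticeQCDFlow.Exactness

open WithLp Set MeasureTheory
open ProbabilityTheory ProbabilityTheory.Kernel
open Literature.MathematicalPhysics.QuantumFieldTheory
open scoped ENNReal Matrix

variable {d L : ℕ} [NeZero L]

/-- **Translation-invariant observables: equal expectations along the runs from `(Θ_a)_*μ₀` and from `μ₀`.** -/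
theorem su2_fthmc_integral_translationInvariant_eq (a : Site d L)
    (F : GaugeConfig d L (Matrix.specialUnitaryGroup (Fin 2) ℂ) ≃ᵐ GaugeConfig d L (Matrix.specialUnitaryGroup (Fin 2) ℂ)) (hF : ∀ V : GaugeConfig d L (Matrix.specialUnitaryGroup (Fin 2) ℂ), F (fun e : Edge d L => V (e.1 + a, e.2)) = (fun e : Edge d L => (F V) (e.1 + a, e.2)))
    {J : GaugeConfig d L (Matrix.specialUnitaryGroup (Fin 2) ℂ) → ℝ} (hJm : Measurable J) (hJ : ∀ V : GaugeConfig d L (Matrix.specialUnitaryGroup (Fin 2) ℂ), J (fun e : Edge d L => V (e.1 + a, e.2)) = J V)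
    {S : GaugeConfig d L (Matrix.specialUnitaryGroup (Fin 2) ℂ) → ℝ} (hS : Measurable S) (hSi : ∀ V : GaugeConfig d L (Matrix.specialUnitaryGroup (Fin 2) ℂ), S (fun e : Edge d L => V (e.1 + a, e.2)) = S V) (c : ℝ)
    {g : GaugeConfig d L (Matrix.specialUnitaryGroup (Fin 2) ℂ) → ((Edge d L × Fin 3) → ℝ)} (hg : Measurable g)
    (hgc : ∀ V : GaugeConfig d L (Matrix.specialUnitaryGroup (Fin 2) ℂ), g (fun e : Edge d L => V (e.1 + a, e.2)) = (fun q : Edge d L × Fin 3 => (g V) ((q.1.1 + a, q.1.2), q.2))) (n : ℕ)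
    {E : Type*} [NormedAddCommGroup E] [NormedSpace ℝ E] {O : GaugeConfig d L (Matrix.specialUnitaryGroup (Fin 2) ℂ) → E} (hO : ∀ V : GaugeConfig d L (Matrix.specialUnitaryGroup (Fin 2) ℂ), O (fun e : Edge d L => V (e.1 + a, e.2)) = O V)
    (μ₀ : Measure (GaugeConfig d L (Matrix.specialUnitaryGroup (Fin 2) ℂ))) (t : ℕ) :
    ∫ U, O U ∂((fun m : Measure (GaugeConfig d L (Matrix.specialUnitaryGroup (Fin 2) ℂ)) => m.bind
      (conjKernel
        (refreshUpdate
          (involMH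
            (⇑((flip : Equiv.Perm (GaugeConfig d L (Matrix.specialUnitaryGroup (Fin 2) ℂ) × ((Edge d L × Fin 3) → ℝ))) *
                leapfrog (mulDrift fun p : ((Edge d L × Fin 3) → ℝ) =>
                  fun ℓ : Edge d L => gaussUnit (toLp 2
          ![Real.cos (c * Real.sqrt (p (ℓ, 0) ^ 2 + p (ℓ, 1) ^ 2 + p (ℓ, 2) ^ 2)),
            c * Real.sinc (c * Real.sqrt (p (ℓ, 0) ^ 2 + p (ℓ, 1) ^ 2 + p (ℓ, 2) ^ 2)) * p (ℓ, 0),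
            c * Real.sinc (c * Real.sqrt (p (ℓ, 0) ^ 2 + p (ℓ, 1) ^ 2 + p (ℓ, 2) ^ 2)) * p (ℓ, 1),
            c * Real.sinc (c * Real.sqrt (p (ℓ, 0) ^ 2 + p (ℓ, 1) ^ 2 + p (ℓ, 2) ^ 2)) * p (ℓ, 2)])) g ^ n))
            (measurable_flip_leapfrog_pow (measurable_mulDrift (measurable_su2Drift c)) hg n)
            fun z : GaugeConfig d L (Matrix.specialUnitaryGroup (Fin 2) ℂ) × ((Edge d L × Fin 3) → ℝ) =>
              (S (F z.1) - Real.log (J z.1)) + ∑ i, z.2 i ^ 2 / 2)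
          ((((volume : Measure ((Edge d L × Fin 3) → ℝ)).withDensity
                  fun p => ENNReal.ofReal (Real.exp (-(∑ i, p i ^ 2 / 2)))) Set.univ)⁻¹ •
              (volume : Measure ((Edge d L × Fin 3) → ℝ)).withDensity
                fun p => ENNReal.ofReal (Real.exp (-(∑ i, p i ^ 2 / 2)))))
        F))^[t]
      (μ₀.map (fun V : GaugeConfig d L (Matrix.specialUnitaryGroup (Fin 2) ℂ) => (fun e : Edge d L => V (e.1 + a, e.2))))) =
    ∫ U, O U ∂((fun m : Measure (GaugeConfig d L (Matrix.specialUnitaryGroup (Fin 2) ℂ)) => m.bind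
      (conjKernel
        (refreshUpdate
          (involMH
            (⇑((flip : Equiv.Perm (GaugeConfig d L (Matrix.specialUnitaryGroup (Fin 2) ℂ) × ((Edge d L × Fin 3) → ℝ))) *
                leapfrog (mulDrift fun p : ((Edge d L × Fin 3) → ℝ) =>
                  fun ℓ : Edge d L => gaussUnit (toLp 2
          ![Real.cos (c * Real.sqrt (p (ℓ, 0) ^ 2 + p (ℓ, 1) ^ 2 + p (ℓ, 2) ^ 2)),
            c * Real.sinc (c * Real.sqrt (p (ℓ, 0) ^ 2 + p (ℓ, 1) ^ 2 + p (ℓ, 2) ^ 2)) * p (ℓ, 0),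
            c * Real.sinc (c * Real.sqrt (p (ℓ, 0) ^ 2 + p (ℓ, 1) ^ 2 + p (ℓ, 2) ^ 2)) * p (ℓ, 1),
            c * Real.sinc (c * Real.sqrt (p (ℓ, 0) ^ 2 + p (ℓ, 1) ^ 2 + p (ℓ, 2) ^ 2)) * p (ℓ, 2)])) g ^ n))
            (measurable_flip_leapfrog_pow (measurable_mulDrift (measurable_su2Drift c)) hg n)
            fun z : GaugeConfig d L (Matrix.specialUnitaryGroup (Fin 2) ℂ) × ((Edge d L × Fin 3) → ℝ) =>
              (S (F z.1) - Real.log (J z.1)) + ∑ i, z.2 i ^ 2 / 2)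
          ((((volume : Measure ((Edge d L × Fin 3) → ℝ)).withDensity
                  fun p => ENNReal.ofReal (Real.exp (-(∑ i, p i ^ 2 / 2)))) Set.univ)⁻¹ •
              (volume : Measure ((Edge d L × Fin 3) → ℝ)).withDensity
                fun p => ENNReal.ofReal (Real.exp (-(∑ i, p i ^ 2 / 2)))))
        F))^[t] μ₀) :=
  integral_iterate_bind_map_eq_of_conjKernel_eq_self
    (su2_fthmc_conjKernel_translate a F hF hJm hJ hS hSi c hg hgc n) μ₀ t (fun U => hO U)

/-- **… and from the configurations `V·a` and `V`, through the `t`-step kernel `nHit K t`.** -/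
theorem su2_fthmc_nHit_integral_translationInvariant_eq (a : Site d L)
    (F : GaugeConfig d L (Matrix.specialUnitaryGroup (Fin 2) ℂ) ≃ᵐ GaugeConfig d L (Matrix.specialUnitaryGroup (Fin 2) ℂ)) (hF : ∀ V : GaugeConfig d L (Matrix.specialUnitaryGroup (Fin 2) ℂ), F (fun e : Edge d L => V (e.1 + a, e.2)) = (fun e : Edge d L => (F V) (e.1 + a, e.2)))
    {J : GaugeConfig d L (Matrix.specialUnitaryGroup (Fin 2) ℂ) → ℝ} (hJm : Measurable J) (hJ : ∀ V : GaugeConfig d L (Matrix.specialUnitaryGroup (Fin 2) ℂ), J (fun e : Edge d L => V (e.1 + a, e.2)) = J V)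
    {S : GaugeConfig d L (Matrix.specialUnitaryGroup (Fin 2) ℂ) → ℝ} (hS : Measurable S) (hSi : ∀ V : GaugeConfig d L (Matrix.specialUnitaryGroup (Fin 2) ℂ), S (fun e : Edge d L => V (e.1 + a, e.2)) = S V) (c : ℝ)
    {g : GaugeConfig d L (Matrix.specialUnitaryGroup (Fin 2) ℂ) → ((Edge d L × Fin 3) → ℝ)} (hg : Measurable g)
    (hgc : ∀ V : GaugeConfig d L (Matrix.specialUnitaryGroup (Fin 2) ℂ), g (fun e : Edge d L => V (e.1 + a, e.2)) = (fun q : Edge d L × Fin 3 => (g V) ((q.1.1 + a, q.1.2), q.2))) (n : ℕ)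
    {E : Type*} [NormedAddCommGroup E] [NormedSpace ℝ E] {O : GaugeConfig d L (Matrix.specialUnitaryGroup (Fin 2) ℂ) → E} (hO : ∀ V : GaugeConfig d L (Matrix.specialUnitaryGroup (Fin 2) ℂ), O (fun e : Edge d L => V (e.1 + a, e.2)) = O V)
    (t : ℕ) (V : GaugeConfig d L (Matrix.specialUnitaryGroup (Fin 2) ℂ)) :
    ∫ U, O U ∂(nHit
      (conjKernel
        (refreshUpdate
          (involMH
            (⇑((flip : Equiv.Perm (GaugeConfig d L (Matrix.specialUnitaryGroup (Fin 2) ℂ) × ((Edge d L × Fin 3) → ℝ))) *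
                leapfrog (mulDrift fun p : ((Edge d L × Fin 3) → ℝ) =>
                  fun ℓ : Edge d L => gaussUnit (toLp 2
          ![Real.cos (c * Real.sqrt (p (ℓ, 0) ^ 2 + p (ℓ, 1) ^ 2 + p (ℓ, 2) ^ 2)),
            c * Real.sinc (c * Real.sqrt (p (ℓ, 0) ^ 2 + p (ℓ, 1) ^ 2 + p (ℓ, 2) ^ 2)) * p (ℓ, 0),
            c * Real.sinc (c * Real.sqrt (p (ℓ, 0) ^ 2 + p (ℓ, 1) ^ 2 + p (ℓ, 2) ^ 2)) * p (ℓ, 1),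
            c * Real.sinc (c * Real.sqrt (p (ℓ, 0) ^ 2 + p (ℓ, 1) ^ 2 + p (ℓ, 2) ^ 2)) * p (ℓ, 2)])) g ^ n))
            (measurable_flip_leapfrog_pow (measurable_mulDrift (measurable_su2Drift c)) hg n)
            fun z : GaugeConfig d L (Matrix.specialUnitaryGroup (Fin 2) ℂ) × ((Edge d L × Fin 3) → ℝ) =>
              (S (F z.1) - Real.log (J z.1)) + ∑ i, z.2 i ^ 2 / 2)
          ((((volume : Measure ((Edge d L × Fin 3) → ℝ)).withDensity
                  fun p => ENNReal.ofReal (Real.exp (-(∑ i, p i ^ 2 / 2)))) Set.univ)⁻¹ •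
              (volume : Measure ((Edge d L × Fin 3) → ℝ)).withDensity
                fun p => ENNReal.ofReal (Real.exp (-(∑ i, p i ^ 2 / 2)))))
        F) t
      (fun e : Edge d L => V (e.1 + a, e.2))) =
    ∫ U, O U ∂(nHit
      (conjKernel
        (refreshUpdate
          (involMH
            (⇑((flip : Equiv.Perm (GaugeConfig d L (Matrix.specialUnitaryGroup (Fin 2) ℂ) × ((Edge d L × Fin 3) → ℝ))) *
                leapfrog (mulDrift fun p : ((Edge d L × Fin 3) → ℝ) =>
                  fun ℓ : Edge d L => gaussUnit (toLp 2
          ![Real.cos (c * Real.sqrt (p (ℓ, 0) ^ 2 + p (ℓ, 1) ^ 2 + p (ℓ, 2) ^ 2)),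
            c * Real.sinc (c * Real.sqrt (p (ℓ, 0) ^ 2 + p (ℓ, 1) ^ 2 + p (ℓ, 2) ^ 2)) * p (ℓ, 0),
            c * Real.sinc (c * Real.sqrt (p (ℓ, 0) ^ 2 + p (ℓ, 1) ^ 2 + p (ℓ, 2) ^ 2)) * p (ℓ, 1),
            c * Real.sinc (c * Real.sqrt (p (ℓ, 0) ^ 2 + p (ℓ, 1) ^ 2 + p (ℓ, 2) ^ 2)) * p (ℓ, 2)])) g ^ n))
            (measurable_flip_leapfrog_pow (measurable_mulDrift (measurable_su2Drift c)) hg n)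
            fun z : GaugeConfig d L (Matrix.specialUnitaryGroup (Fin 2) ℂ) × ((Edge d L × Fin 3) → ℝ) =>
              (S (F z.1) - Real.log (J z.1)) + ∑ i, z.2 i ^ 2 / 2)
          ((((volume : Measure ((Edge d L × Fin 3) → ℝ)).withDensity
                  fun p => ENNReal.ofReal (Real.exp (-(∑ i, p i ^ 2 / 2)))) Set.univ)⁻¹ •
              (volume : Measure ((Edge d L × Fin 3) → ℝ)).withDensity
                fun p => ENNReal.ofReal (Real.exp (-(∑ i, p i ^ 2 / 2)))))
        F) t V) :=
  integral_nHit_eq_of_conjKernel_eq_self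
    (su2_fthmc_conjKernel_translate a F hF hJm hJ hS hSi c hg hgc n) t V (fun U => hO U)

end Summit.Ventures.LatticeQCDFlow.Exactness
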